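import Mathlib
import Summits.Ventures.PercRepro2.SwOutNeverCoreAsym
import Summits.Ventures.PercRepro2.SwOutArmGTyped

/-!
# The never-core criterion on the general doubly typed side (blind cell PercRepro2, night-4 g30,
2026-08-28; proofs/NIGHT4-G30.md §9)

g28's never-core criterion (`NeverCoreF`, the closure of «outside edge», «no edge», «forced»,
«separated from `h` by one edge», «separated by a never-core vertex») on night-4 g7's general
doubly typed side `gTypedQ ends l h 𝓤 𝓓 𝓓″ X 𝓤′`: the forced vertices are those forced into
`C_R(l)` by `𝓤`, forced out of `C_R(h)` by `𝓓″`, or in `X` (`NeverCoreF.not_core_g`);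
`rigidOK_g_of_neverCoreF`, **`gTypedSwAll_of_neverCoreF`**, **`gTypedSwAll_of_bridges`**: the
general doubly typed row on g28's never-core and bridge classes, for every admissible choice of
the five conditions.
-/

namespace Summit.Ventures.PercRepro2

namespace LocRows

open Hull

variable {V : Type*} {E : Type*} [Fintype E] [DecidableEq E]

open scoped Classical

variable {ends : E → Sym2 V} {U : Set V} {ξ : Config E} {l h : V} {F : V → Prop}
  {𝓤 𝓓 𝓓'' : Set (Set V)} {X : Set V} {𝓤' : Set (Set V)}

/-- **A `NeverCoreF` vertex other than `h` is in both clusters of `h` at no `gTypedQ`-point of the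
class**, when the forced vertices are forced into `C_R(l)`, forced out of `C_R(h)`, or in `X`. -/
theorem NeverCoreF.not_core_g
    (hF : ∀ x, F x → (∀ S ∈ 𝓤, x ∈ S) ∨ (∀ S ∈ 𝓓'', x ∉ S) ∨ x ∈ X) {x : V}
    (hN : NeverCoreF ends U h F x) (hxh : x ≠ h) {ζ : Config E}
    (hζ : ζ ∈ gOutSide ends l h 𝓤 𝓓 𝓓'' X 𝓤' U ξ) (hxT : x ∈ cluster ends ζ h)
    (hxTp : x ∈ cluster ends (blue ζ) h) : False := by
  have hQ := (mem_gOutSide.1 hζ).1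
  have hcl := (mem_gOutSide.1 hζ).2
  have hT : cluster ends ζ h ⊆ U := fun y hy => (mem_outClass.1 hcl).2 (Or.inl hy)
  have hTp : cluster ends (blue ζ) h ⊆ U := fun y hy => (mem_outClass.1 hcl).2 (Or.inr hy)
  induction hN with
  | out x e y hxy hyU =>
    cases he : ζ e with
    | true => exact hyU (hT (mem_cluster_of_edge hxT he hxy))
    | false =>
      have he' : blue ζ e = true := by rw [blue_eq_true_iff]; exact he
      exact hyU (hTp (mem_cluster_of_edge hxTp he' hxy))
  | iso x hiso =>
    obtain ⟨e, hxe⟩ := exists_edge_of_mem_cluster hxT hxh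
    exact hiso e hxe
  | forced x hx =>
    rw [mem_gTypedQ] at hQ
    obtain ⟨hh, hA, -, hRh, hX, -⟩ := hQ
    rcases hF x hx with hf | hf'' | hxX
    · exact hh (Or.inl (conn_trans (hf _ hA) (conn_symm hxT)))
    · exact hf'' _ hRh hxT
    · exact hX x hxX (Or.inl hxT)
  | edge x e₀ hx => exact not_core_of_cut (mem_outClass.1 hcl).2 hx hxT hxTp
  | vertex x w _ hwx hwh hx ih =>
    have hwT : w ∈ cluster ends ζ h := by
      by_contra hw
      exact hx (cluster_subset_cluster_avoid hT hw hxT)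
    have hwTp : w ∈ cluster ends (blue ζ) h := by
      by_contra hw
      exact hx (cluster_subset_cluster_avoid hTp hw hxTp)
    exact ih hwh hwT hwTp

/-- **Every `gTypedQ`-point of the class is core-free** when every vertex of `U ∖ {h}` is
`NeverCoreF`. -/
theorem coreFree_of_neverCoreF_g
    (hF : ∀ x, F x → (∀ S ∈ 𝓤, x ∈ S) ∨ (∀ S ∈ 𝓓'', x ∉ S) ∨ x ∈ X)
    (hN : ∀ x ∈ U, x ≠ h → NeverCoreF ends U h F x) {ζ : Config E}
    (hζ : ζ ∈ gOutSide ends l h 𝓤 𝓓 𝓓'' X 𝓤' U ξ) : CoreFree ends ζ h := by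
  intro x hxT hxTp
  by_contra hxh
  have hcl := (mem_gOutSide.1 hζ).2
  have hxU : x ∈ U := (mem_outClass.1 hcl).2 (Or.inl hxT)
  exact (hN x hxU hxh).not_core_g hF hxh hζ hxT hxTp

/-- **The rigid inequality on the general doubly typed side of every class of a region whose
vertices other than `h` are `NeverCoreF`** (no loop at `h`). -/
theorem rigidOK_g_of_neverCoreF (h𝓤 : IsUpperSet 𝓤) (h𝓓 : IsLowerSet 𝓓) (h𝓓'' : IsLowerSet 𝓓'')
    (h𝓤' : IsUpperSet 𝓤') (hl : l ∉ U) (hloop : ∀ e, ends e ≠ s(h, h))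
    (hF : ∀ x, F x → (∀ S ∈ 𝓤, x ∈ S) ∨ (∀ S ∈ 𝓓'', x ∉ S) ∨ x ∈ X)
    (hN : ∀ x ∈ U, x ≠ h → NeverCoreF ends U h F x) {𝓔 : Set (Set E)} (h𝓔 : IsUpperSet 𝓔) :
    ((gOutSide ends l h 𝓤 𝓓 𝓓'' X 𝓤' U ξ).filter fun ζ => redEdges ends ζ h ∈ 𝓔).card ≤
      ((gOutSide ends l h 𝓤 𝓓 𝓓'' X 𝓤' U ξ).filter fun ζ => blueEdges ends ζ h ∈ 𝓔).card :=
  rigidOK_g_of_coreFree h𝓤 h𝓓 h𝓓'' h𝓤' hl hloop (fun _ hζ => coreFree_of_neverCoreF_g hF hN hζ) h𝓔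

/-- **The general doubly typed row on every graph whose vertices other than `l, h` are
`NeverCoreF` in the region `{l}ᶜ`** (no loop at `h`), the forced vertices exempt by the five
conditions. -/
theorem gTypedSwAll_of_neverCoreF (hlh : l ≠ h) (hloop : ∀ e, ends e ≠ s(h, h))
    (h𝓤 : IsUpperSet 𝓤) (h𝓓 : IsLowerSet 𝓓) (h𝓓'' : IsLowerSet 𝓓'') (h𝓤' : IsUpperSet 𝓤')
    (hF : ∀ x, F x → (∀ S ∈ 𝓤, x ∈ S) ∨ (∀ S ∈ 𝓓'', x ∉ S) ∨ x ∈ X)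
    (hN : ∀ x, x ≠ l → x ≠ h → NeverCoreF ends ({l}ᶜ) h F x) :
    GTypedSwAll ends l h 𝓤 𝓓 𝓓'' X 𝓤' := by
  refine exists_swAll_injection_of_card_le h _ (card_le_g_of_classes hlh fun ξ 𝓔 h𝓔 => ?_)
  exact rigidOK_g_of_neverCoreF (ξ := ξ) h𝓤 h𝓓 h𝓓'' h𝓤' (by simp) hloop hF
    (fun x hx hxh => hN x (by simpa using hx) hxh) h𝓔

/-- **The general doubly typed row on every graph with bridge junctions** (g28's class). -/
theorem gTypedSwAll_of_bridges (hlh : l ≠ h) (hloop : ∀ e, ends e ≠ s(h, h))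
    (h𝓤 : IsUpperSet 𝓤) (h𝓓 : IsLowerSet 𝓓) (h𝓓'' : IsLowerSet 𝓓'') (h𝓤' : IsUpperSet 𝓤')
    (hbr : ∀ x, x ≠ l → x ≠ h → (∀ S ∈ 𝓤, x ∈ S) ∨ (∀ S ∈ 𝓓'', x ∉ S) ∨ x ∈ X ∨
      (∃ e, ends e = s(x, l)) ∨ (∀ e, x ∉ ends e) ∨
      ∃ e₀, x ∉ cluster ends (cutConfig ends ({l}ᶜ) e₀) h) :
    GTypedSwAll ends l h 𝓤 𝓓 𝓓'' X 𝓤' := by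
  refine gTypedSwAll_of_neverCoreF
    (F := fun x => (∀ S ∈ 𝓤, x ∈ S) ∨ (∀ S ∈ 𝓓'', x ∉ S) ∨ x ∈ X) hlh hloop h𝓤 h𝓓 h𝓓'' h𝓤'
    (fun x hx => hx) fun x hxl hxh => ?_
  rcases hbr x hxl hxh with hf | hf'' | hxX | ⟨e, he⟩ | hiso | ⟨e₀, hx⟩
  · exact NeverCoreF.forced x (Or.inl hf)
  · exact NeverCoreF.forced x (Or.inr (Or.inl hf''))
  · exact NeverCoreF.forced x (Or.inr (Or.inr hxX))
  · exact NeverCoreF.out x e l he (by simp)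
  · exact NeverCoreF.iso x hiso
  · exact NeverCoreF.edge x e₀ hx

end LocRows

end Summit.Ventures.PercRepro2
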